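import Summits.BirchSwinnertonDyer.Rank1Residual.Additive.X4RankZeroVisibleRefinedCertificateSharp
import Summits.BirchSwinnertonDyer.Rank1Residual.Additive.X4RankZeroVisibleRefinedCertificateSockets
import HarnessLib

/-!
# Record sockets over the SHARP-Kato (G) visibility ENDs, prime-list form: Tamagawa READING and
# Tamagawa DEFECT `≤ 1`, the place `3` PAID
# (cell `b2b-bsdres`, team n1011, row T-GSHARP FILE 2 = the sockets the D44 / D44-K / PASS⁺ (G) records
# with `3 ∣ ∏ c_ℓ` elaborate against; seat p04 GEN 12; route planner 1 ST-51c "(U-TAM)", n1011-p09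
# GEN 13's T-D44-REC located gap — 90 (G) rows with `3 ∣ ∏ c_ℓ(E)` or an undecided Tamagawa bracket)

HONEST FRAMING (cell `b2b-bsdres`, run/shared/lean/b2b/bsd-rank1-residual/, verbatim in every
file): the goal of the cell is to DELETE the COMBINATION-SHAPED residual classes of the
Birch–Swinnerton-Dyer formula for ALL analytic-rank `≤ 1` elliptic curves over `ℚ` — "full BSD
formula for every rank `≤ 1` curve in class `C`" assembled STRICTLY from published theorems — so
that the rank-`≤ 1` remainder becomes exactly the CONSTRUCTION-SHAPED classes, which are TYPED
(missing-input `Prop`s), NOT attempted. This is not "finishing BSD". Team n1011 (N10 / N11, the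
additive block X4 ∧ `p = 3`): research route on the CONSTRUCTION-SHAPED class X4; no claim beyond
the stated classes; nothing is booked; no mark / label / count is changed by this file. Theorems
only (no definition, no new named fact, no `sorry`). The sockets are CONDITIONAL on the displayed
named facts of the sharp (G) ENDs (FILE 1: `hKatoS`, `hCT`, `hGZK`, `hmod`, `hU`, `hU2`) and CLOSE
NOTHING by themselves: a per-row RECORD discharges `θ`, the integer models and discriminant
supports, `#E′(ℚ₃)[3] ≤ t`, the Tamagawa reading / defect `htam` and every disjunct of `hplaces` in
the kernel, and carries `hr`, `hq`/`hv`/`hev`, `hrank` and the parametrisation datum `D`/`hc` as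
EVIDENCE / displayed binders (ruling of record for row shapes, n1011 lead R5-82 (d)).

## What

FILE 6 (`X4RankZeroVisibleRefinedCertificateSockets.lean`) serves the potentially good rows with
`3 ∤ ∏ c_ℓ(E)` through `X4RankZero.bsdp_three_of_congr_of_places₇_of_kato_of_primeList_paidThree`.
Here, over FILE 1's sharp ENDs `X4RankZero.bsdp_three_of_congr_of_places₇_of_katoSharp[_of_tamDefect_le_one]`
and FILE 6's plumbing `exists_paidPlace_three` (T = {v₃}, `#E′(ℚ₃)[3]·#(ℤ₃/3ℤ₃) ≤ 3t < 3^k ≤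
3^{rank E′}`), with FILE 6's binder ORDER token for token (`hKato ↦ hKatoS`, `htam` retyped, `hev`
inserted after `hv` in the defect twin — a records generator changes three tokens per row):

* §0 `padicValNat_le_succ_of_eq_mul[_three_mul]` — records arithmetic for the defect binder (n1011-p09
  GEN 13's lemmas, attributed adoption per lead R5-99 (a));
* `X4RankZero.bsdp_three_of_congr_of_places₇_of_katoSharp_of_primeList_paidThree` — Tamagawa
  READING `ord₃ ∏ c_ℓ = ord₃ c(W/ℚ_[3])` (defect `0`; the `c₃ = 3` rows included);
* `X4RankZero.bsdp_three_of_congr_of_places₇_of_katoSharp_of_tamDefect_le_one_of_primeList_paidThree`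
  — Tamagawa DEFECT `≤ 1` with `hev : Even (ord₃ #Ш_an)` (Cassels–Tate parity).
Rows of defect `≥ 2` have no socket here (sharp Kato + parity give `ord₃ #Ш ∈ {ord₃ #Ш_an,
ord₃ #Ш_an + 2}`): LOWER-ONLY, a located gap.

References: [CremonaMazur2000] §3 and Table 1; [AgasheStein2002] Thm. 3.1; [Kato2004Asterisque]
Thm. 14.5 (3), Prop. 14.16 (2); [Kim2022StructureSelmer] §3.2.3; [SilvermanAEC2009] VII.5.1, X.4.14;
[SilvermanATAEC1994] Ch. V; [Miller2011LMS] Def. 1.1; cells/n1011/ROUTE-1.md §41.5, §44, §51 (ST-51c).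
-/

set_option autoImplicit false

noncomputable section

open scoped Classical NumberField
open IsDedekindDomain NumberField WeierstrassCurve Rat.HeightOneSpectrum
  Literature.NumberTheory.EllipticCurves Literature.NumberTheory.EllipticCurves.ModularForms
  Literature.NumberTheory.EllipticCurves.Rank1Residual
  Literature.NumberTheory.EllipticCurves.Rank1Residual.Typed
  Literature.NumberTheory.GaloisRepresentations
  Summit.BirchSwinnertonDyer.Rank1Residual.GaloisImage

namespace Summit.BirchSwinnertonDyer.Rank1Residual.Additive

/-! ### §0. Records arithmetic: the Tamagawa DEFECT inequality from two kernel numerals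
(n1011-p09 GEN 13's two lemmas, adopted here BY ATTRIBUTED STATIC COPY per n1011 lead R5-99 (a) —
statements and proofs byte-identical to `HOME/b2b-bsdres-n1011-p09/gen13/X4RankZeroVisibleRefinedCertificateKatoSharp.lean`
ll. 64–84; the defect-0 READING `ord₃ ∏ c_ℓ = ord₃ c₃` is p03's
`IntModelTam.padicValNat_eq_padicValNat_of_eq_mul`, `Additive/IntModelTamagawaCertificateLocal.lean`) -/

/-- **Tamagawa defect ≤ 1 from the exact values**: if `∏ c_ℓ = c₃ · 3 · m` with `3 ∤ m` (ONE factor `3` among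
the `c_ℓ`, `ℓ ≠ 3`) then `ord₃ ∏ c_ℓ ≤ ord₃ c₃ + 1`; records rewrite `W.tamagawaProduct` and
`(W.baseChange ℚ_[3]).localTamagawaNumber ℤ_[3]` to their certified values first (n1011-p09 GEN 13,
attributed copy). [folklore] -/
theorem padicValNat_le_succ_of_eq_mul_three_mul {a b m : ℕ} (h : a = b * (3 * m)) (hb : b ≠ 0)
    (hm : ¬ 3 ∣ m) : padicValNat 3 a ≤ padicValNat 3 b + 1 := by
  haveI : Fact (Nat.Prime 3) := ⟨Nat.prime_three⟩
  have hm0 : m ≠ 0 := fun h0 ↦ hm (h0 ▸ dvd_zero 3)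
  subst h
  rw [padicValNat.mul hb (by positivity), padicValNat.mul (by norm_num) hm0, padicValNat.self (by norm_num),
    padicValNat.eq_zero_of_not_dvd hm]

/-- **Tamagawa defect 0 from the exact values**: `∏ c_ℓ = c₃ · m` with `3 ∤ m` gives `ord₃ ∏ c_ℓ ≤ ord₃ c₃ + 1`
trivially (in fact equality of the orders: `IntModelTam.padicValNat_eq_padicValNat_of_eq_mul`, which the
READING socket takes) (n1011-p09 GEN 13, attributed copy). [folklore] -/
theorem padicValNat_le_succ_of_eq_mul {a b m : ℕ} (h : a = b * m) (hb : b ≠ 0) (hm : ¬ 3 ∣ m) :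
    padicValNat 3 a ≤ padicValNat 3 b + 1 := by
  haveI : Fact (Nat.Prime 3) := ⟨Nat.prime_three⟩
  have hm0 : m ≠ 0 := fun h0 ↦ hm (h0 ▸ dvd_zero 3)
  subst h
  rw [padicValNat.mul hb hm0, padicValNat.eq_zero_of_not_dvd hm]
  omega

/-! ### §1. The record sockets in prime-list form (`S` = the places over a list `L ∋ 3`, the place `3` PAID) -/

/-- **Record socket, potentially GOOD rows, SHARP Kato, Tamagawa READING `ord₃ ∏ c_ℓ = ord₃ c₃`, the
place `3` PAID** (FILE 6's `X4RankZero.bsdp_three_of_congr_of_places₇_of_kato_of_primeList_paidThree`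
with `hKato ↦ hKatoS` and `htam : ¬ 3 ∣ ∏ c_ℓ ↦ htam : ord₃ ∏ c_ℓ = ord₃ c(W/ℚ_[3])`, every other
binder token for token; serves in addition the `c₃ = 3` Kodaira IV / IV* rows whose other `c_ℓ` are
prime to `3`): `BSD(E,3)` for an X4 ∧ `r_an = 0` row, `ord₃ j(E) ≥ 0`, the `3`-adic tower onto, a
parametrisation datum with `3 ∤ c_D`, `ord₃ #Ш_an ≤ 2`, from a `3`-congruent partner with
`#E′(ℚ₃)[3] ≤ t`, `3t < 3^k`, `k ≤ rank E′(ℚ)`, every other place over `L ∋ 3` of one of the seven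
kinds. The reading is discharged per row from the integral model (p03's `IntModelTam.*` certificates,
pattern `IntModelTam.tamagawaReading_v11286q1`). [cite: CremonaMazur2000, §3 and Table 1]
[cite: AgasheStein2002, Thm. 3.1] [cite: Kato2004Asterisque, Thm. 14.5 (3) (p. 236), Prop. 14.16 (2) (p. 244)]
[cite: SilvermanAEC2009, Thm. X.4.14] -/
theorem X4RankZero.bsdp_three_of_congr_of_places₇_of_katoSharp_of_primeList_paidThree
    (hKatoS : Kato2004.rankZero_padicValNat_sha_le_sub_localTamagawa_of_additive_potGood_of_imageContainsSL2)
    (hCT : exists_casselsTate_pairing (K := ℚ))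
    (hGZK : rank_eq_analyticRank_of_analyticRank_le_one) (hmod : hasEntireLFunction_rat)
    (hU : Silverman1994_thmV53_tateUniformisation.{0})
    (hU2 : Silverman1994_thmV53_corV54_tateUniformisation.{0})
    (W : WeierstrassCurve ℚ) [W.IsElliptic] [W.IsGloballyMinimal]
    (hr : W.analyticRank = 0) (hX : haveI : Fact (Nat.Prime 3) := ⟨Nat.prime_three⟩; ClassX4 W 3)
    (hpot : 0 ≤ padicValRat 3 W.j)
    (hsurj : ∀ n : ℕ, W.HasSurjectiveModNGaloisRep (3 ^ n : ℕ))
    (htam : haveI : Fact (Nat.Prime 3) := ⟨Nat.prime_three⟩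
      padicValNat 3 W.tamagawaProduct =
        padicValNat 3 ((W.baseChange ℚ_[3]).localTamagawaNumber ℤ_[3]))
    {N : ℕ} [NeZero N] (D : ModularParametrizationData W N) (hc : ¬ (3 : ℤ) ∣ D.maninConstant)
    {q : ℚ} (hq : shaAn W = (q : ℂ)) (hv : padicValRat 3 q ≤ 2)
    (W' : WeierstrassCurve ℚ) [W'.IsElliptic]
    (θ : geomTorsion W' ((3 : ℕ) : ℤ) ≃+ geomTorsion W ((3 : ℕ) : ℤ))
    (hθ : ∀ (σ : Field.absoluteGaloisGroup ℚ) (P : geomTorsion W' ((3 : ℕ) : ℤ)),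
      θ (σ • P) = σ • θ P)
    {t k : ℕ} (htors₃ : ∀ w : HeightOneSpectrum (𝓞 ℚ), (primesEquiv w : ℕ) = 3 →
      Nat.card (nsmulAddMonoidHom 3 :
        (W'.baseChange (w.adicCompletion ℚ)).toAffine.Point →+ _).ker ≤ t)
    (hbudget : 3 * t < 3 ^ k) (hrank : k ≤ W'.mordellWeilRank)
    {E₀ F₀ : WeierstrassCurve ℤ} (hE : E₀.map (Int.castRingHom ℚ) = W)
    (hF : F₀.map (Int.castRingHom ℚ) = W') (L : List ℕ) (h3L : 3 ∈ L)
    (hΔE : ∀ q : ℕ, q.Prime → (q : ℤ) ∣ E₀.Δ → q ∈ L)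
    (hΔF : ∀ q : ℕ, q.Prime → (q : ℤ) ∣ F₀.Δ → q ∈ L)
    (hplaces : ∀ w : HeightOneSpectrum (𝓞 ℚ), (primesEquiv w : ℕ) ∈ L → (primesEquiv w : ℕ) ≠ 3 →
      (((3 : ℕ) : 𝓞 ℚ) ∉ w.asIdeal ∧ Nat.card (nsmulAddMonoidHom 3 :
          (W'.baseChange (w.adicCompletion ℚ)).toAffine.Point →+ _).ker = 1) ∨
      (W.HasSplitMultiplicativeReductionAt w ∧ W'.HasSplitMultiplicativeReductionAt w ∧
        Nat.card (nsmulAddMonoidHom 3 :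
          (W.baseChange (w.adicCompletion ℚ)).toAffine.Point →+ _).ker ≤ 3) ∨
      (W.HasMultiplicativeReductionAt w ∧ W'.HasMultiplicativeReductionAt w ∧
        (∃ r : w.adicCompletion ℚ, algebraMap ℚ (w.adicCompletion ℚ) (-(W.c₄ / W.c₆)) =
          r ^ 2 * algebraMap ℚ (w.adicCompletion ℚ) (-(W'.c₄ / W'.c₆))) ∧
        (∀ ζ : w.adicCompletion ℚ, ζ ^ 3 = 1 → ζ = 1)) ∨
      (W.HasMultiplicativeReductionAt w ∧
        ¬ IsSquare (algebraMap ℚ (w.adicCompletion ℚ) (-(W.c₄ / W.c₆))) ∧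
        W'.HasGoodReductionAt w ∧ ((3 : ℕ) : 𝓞 ℚ) ∉ w.asIdeal) ∨
      (W.HasGoodReductionAt w ∧ W'.HasMultiplicativeReductionAt w ∧
        ¬ IsSquare (algebraMap ℚ (w.adicCompletion ℚ) (-(W'.c₄ / W'.c₆))) ∧
        ((3 : ℕ) : 𝓞 ℚ) ∉ w.asIdeal) ∨
      (1 < w.valuation ℚ W.j ∧ 1 < w.valuation ℚ W'.j ∧
        (∃ r : w.adicCompletion ℚ, algebraMap ℚ (w.adicCompletion ℚ) (-(W.c₄ / W.c₆)) =
          r ^ 2 * algebraMap ℚ (w.adicCompletion ℚ) (-(W'.c₄ / W'.c₆))) ∧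
        (∀ ζ : w.adicCompletion ℚ, ζ ^ 3 = 1 → ζ = 1)) ∨
      (W.HasAdditiveReductionAt w ∧ W'.HasAdditiveReductionAt w ∧ ((3 : ℕ) : 𝓞 ℚ) ∉ w.asIdeal ∧
        Nat.card (nsmulAddMonoidHom 3 :
          (W'.baseChange (w.adicCompletion ℚ)).toAffine.Point →+ _).ker = 3)) :
    haveI : Fact (Nat.Prime 3) := ⟨Nat.prime_three⟩
    BSDp W 3 := by
  haveI : Fact (Nat.Prime 3) := ⟨Nat.prime_three⟩
  obtain ⟨S, hS⟩ := exists_placeFinset_of_primeList L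
  obtain ⟨T, hTS, hT, hT3⟩ := exists_paidPlace_three W' L h3L hS htors₃ hbudget hrank
  exact X4RankZero.bsdp_three_of_congr_of_places₇_of_katoSharp hKatoS hCT hGZK hmod W hr hX hpot hsurj
    htam D hc hq hv hU hU2 W' θ hθ S T hTS
    (good_and_not_mem_of_not_mem_placeFinset hE hF L Nat.prime_three h3L hΔE hΔF hS) hT
    (fun w hw hwT ↦ hplaces w ((hS w).mp hw) (hT3 w hw hwT))


/-- **Record socket, potentially GOOD rows, SHARP Kato + Cassels–Tate parity, Tamagawa DEFECT `≤ 1`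
(`ord₃ ∏ c_ℓ ≤ ord₃ c₃ + 1`), `ord₃ #Ш_an ≤ 2` and EVEN, the place `3` PAID** (as
`X4RankZero.bsdp_three_of_congr_of_places₇_of_katoSharp_of_primeList_paidThree` with the reading
relaxed to defect `≤ 1` and ONE extra EVIDENCE binder `hev : Even (ord₃ q)` inserted after `hv`):
`BSD(E,3)` for an X4 ∧ `r_an = 0` row, `ord₃ j(E) ≥ 0`, the `3`-adic tower onto, a parametrisation
datum with `3 ∤ c_D`, from a `3`-congruent partner with `#E′(ℚ₃)[3] ≤ t`, `3t < 3^k`,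
`k ≤ rank E′(ℚ)`, every other place over `L ∋ 3` of one of the seven kinds. The defect is discharged per
row from the integral model (p03's `IntModelTam.*` certificates). [cite: CremonaMazur2000, §3 and Table 1]
[cite: AgasheStein2002, Thm. 3.1] [cite: Kato2004Asterisque, Thm. 14.5 (3) (p. 236), Prop. 14.16 (2) (p. 244)]
[cite: SilvermanAEC2009, Thm. X.4.14] -/
theorem X4RankZero.bsdp_three_of_congr_of_places₇_of_katoSharp_of_tamDefect_le_one_of_primeList_paidThree
    (hKatoS : Kato2004.rankZero_padicValNat_sha_le_sub_localTamagawa_of_additive_potGood_of_imageContainsSL2)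
    (hCT : exists_casselsTate_pairing (K := ℚ))
    (hGZK : rank_eq_analyticRank_of_analyticRank_le_one) (hmod : hasEntireLFunction_rat)
    (hU : Silverman1994_thmV53_tateUniformisation.{0})
    (hU2 : Silverman1994_thmV53_corV54_tateUniformisation.{0})
    (W : WeierstrassCurve ℚ) [W.IsElliptic] [W.IsGloballyMinimal]
    (hr : W.analyticRank = 0) (hX : haveI : Fact (Nat.Prime 3) := ⟨Nat.prime_three⟩; ClassX4 W 3)
    (hpot : 0 ≤ padicValRat 3 W.j)
    (hsurj : ∀ n : ℕ, W.HasSurjectiveModNGaloisRep (3 ^ n : ℕ))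
    (htam : haveI : Fact (Nat.Prime 3) := ⟨Nat.prime_three⟩
      padicValNat 3 W.tamagawaProduct ≤
        padicValNat 3 ((W.baseChange ℚ_[3]).localTamagawaNumber ℤ_[3]) + 1)
    {N : ℕ} [NeZero N] (D : ModularParametrizationData W N) (hc : ¬ (3 : ℤ) ∣ D.maninConstant)
    {q : ℚ} (hq : shaAn W = (q : ℂ)) (hv : padicValRat 3 q ≤ 2) (hev : Even (padicValRat 3 q))
    (W' : WeierstrassCurve ℚ) [W'.IsElliptic]
    (θ : geomTorsion W' ((3 : ℕ) : ℤ) ≃+ geomTorsion W ((3 : ℕ) : ℤ))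
    (hθ : ∀ (σ : Field.absoluteGaloisGroup ℚ) (P : geomTorsion W' ((3 : ℕ) : ℤ)),
      θ (σ • P) = σ • θ P)
    {t k : ℕ} (htors₃ : ∀ w : HeightOneSpectrum (𝓞 ℚ), (primesEquiv w : ℕ) = 3 →
      Nat.card (nsmulAddMonoidHom 3 :
        (W'.baseChange (w.adicCompletion ℚ)).toAffine.Point →+ _).ker ≤ t)
    (hbudget : 3 * t < 3 ^ k) (hrank : k ≤ W'.mordellWeilRank)
    {E₀ F₀ : WeierstrassCurve ℤ} (hE : E₀.map (Int.castRingHom ℚ) = W)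
    (hF : F₀.map (Int.castRingHom ℚ) = W') (L : List ℕ) (h3L : 3 ∈ L)
    (hΔE : ∀ q : ℕ, q.Prime → (q : ℤ) ∣ E₀.Δ → q ∈ L)
    (hΔF : ∀ q : ℕ, q.Prime → (q : ℤ) ∣ F₀.Δ → q ∈ L)
    (hplaces : ∀ w : HeightOneSpectrum (𝓞 ℚ), (primesEquiv w : ℕ) ∈ L → (primesEquiv w : ℕ) ≠ 3 →
      (((3 : ℕ) : 𝓞 ℚ) ∉ w.asIdeal ∧ Nat.card (nsmulAddMonoidHom 3 :
          (W'.baseChange (w.adicCompletion ℚ)).toAffine.Point →+ _).ker = 1) ∨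
      (W.HasSplitMultiplicativeReductionAt w ∧ W'.HasSplitMultiplicativeReductionAt w ∧
        Nat.card (nsmulAddMonoidHom 3 :
          (W.baseChange (w.adicCompletion ℚ)).toAffine.Point →+ _).ker ≤ 3) ∨
      (W.HasMultiplicativeReductionAt w ∧ W'.HasMultiplicativeReductionAt w ∧
        (∃ r : w.adicCompletion ℚ, algebraMap ℚ (w.adicCompletion ℚ) (-(W.c₄ / W.c₆)) =
          r ^ 2 * algebraMap ℚ (w.adicCompletion ℚ) (-(W'.c₄ / W'.c₆))) ∧
        (∀ ζ : w.adicCompletion ℚ, ζ ^ 3 = 1 → ζ = 1)) ∨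
      (W.HasMultiplicativeReductionAt w ∧
        ¬ IsSquare (algebraMap ℚ (w.adicCompletion ℚ) (-(W.c₄ / W.c₆))) ∧
        W'.HasGoodReductionAt w ∧ ((3 : ℕ) : 𝓞 ℚ) ∉ w.asIdeal) ∨
      (W.HasGoodReductionAt w ∧ W'.HasMultiplicativeReductionAt w ∧
        ¬ IsSquare (algebraMap ℚ (w.adicCompletion ℚ) (-(W'.c₄ / W'.c₆))) ∧
        ((3 : ℕ) : 𝓞 ℚ) ∉ w.asIdeal) ∨
      (1 < w.valuation ℚ W.j ∧ 1 < w.valuation ℚ W'.j ∧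
        (∃ r : w.adicCompletion ℚ, algebraMap ℚ (w.adicCompletion ℚ) (-(W.c₄ / W.c₆)) =
          r ^ 2 * algebraMap ℚ (w.adicCompletion ℚ) (-(W'.c₄ / W'.c₆))) ∧
        (∀ ζ : w.adicCompletion ℚ, ζ ^ 3 = 1 → ζ = 1)) ∨
      (W.HasAdditiveReductionAt w ∧ W'.HasAdditiveReductionAt w ∧ ((3 : ℕ) : 𝓞 ℚ) ∉ w.asIdeal ∧
        Nat.card (nsmulAddMonoidHom 3 :
          (W'.baseChange (w.adicCompletion ℚ)).toAffine.Point →+ _).ker = 3)) :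
    haveI : Fact (Nat.Prime 3) := ⟨Nat.prime_three⟩
    BSDp W 3 := by
  haveI : Fact (Nat.Prime 3) := ⟨Nat.prime_three⟩
  obtain ⟨S, hS⟩ := exists_placeFinset_of_primeList L
  obtain ⟨T, hTS, hT, hT3⟩ := exists_paidPlace_three W' L h3L hS htors₃ hbudget hrank
  exact X4RankZero.bsdp_three_of_congr_of_places₇_of_katoSharp_of_tamDefect_le_one hKatoS hCT hGZK hmod W
    hr hX hpot hsurj htam D hc hq hv hev hU hU2 W' θ hθ S T hTS
    (good_and_not_mem_of_not_mem_placeFinset hE hF L Nat.prime_three h3L hΔE hΔF hS) hT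
    (fun w hw hwT ↦ hplaces w ((hS w).mp hw) (hT3 w hw hwT))


end Summit.BirchSwinnertonDyer.Rank1Residual.Additive

end
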